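import Summits.Ventures.PercRepro.RankLevelSetPerElemLow

/-! # RankLevelSetStarPlusLow — THE REFLECTIONS (★★)⁺ AT THE LEVELS `i = 1, 2` FOR EVERY FINITE MATROID AND
EVERY ELEMENT: `A^y_1 ≤ A^y_{#E − 1}` AND `A^y_2 ≤ A^y_{#E − 2}` (night-1 g35; dossier §47.7; on
`RankLevelSetPerElemLow`)

For a finite matroid `M` on `n = #E` elements and `y ∈ E`, `A^y_k = lowAbsorbCount M y k` counts the bi-independent
`k`-sets `Z` with `y ∉ Z`, `y ∈ cl Z`. g31's reflection (★★)⁺ is `A^y_i ≤ A^y_{n−i}` for `2i < n`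
(`BiIndepStarPlus`, g32); together with the star steps (ABS-star) it is the full normalized half rule (ABS-norm).

THEOREMS. **`starPlus_one`**: `A^y_1 ≤ A^y_{n−1}` when `3 ≤ n`; **`starPlus_two`**: `A^y_2 ≤ A^y_{n−2}` when
`5 ≤ n` — for every finite matroid and every element. PROOF. A loop absorbs nothing. For `y` in a parallel pair
`{y, z}` both sides are the same count of the minor `N = M ／ {y} ＼ {z}` (g32's `A^y_{j+1}(M) = D_j(N)` and the
symmetry `D_j(N) = D_{#E(N) − j}(N)`). For a `y` without a parallel partner: at level `1` nothing absorbs `y`; at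
level `2` an absorbing `Z = {a, b}` (so `{y, a, b}` is a circuit) is sent to `W := E ∖ {y, e}` for an `e` outside
`Z ∪ {y}` with `E ∖ {y, e}` independent (`exists_through_pair`: a non-coloop `e` makes `E ∖ {e}` spanning, and
`y ∈ cl (E ∖ {y, e})` as `Z ⊆ E ∖ {y, e}`, so `E ∖ {y, e}` has rank `≥ n − 2 = ` its size; if every element
outside `Z ∪ {y}` is a coloop, `E ∖ {y}` is independent); `W` is an absorbing `(n − 2)`-set avoiding `y` with the
independent complement `{y, e}`, and `Z` is recovered as the fundamental circuit of `y` in `W` minus `y`, so the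
map is injective. Every declaration has a docstring; imports: the cell's own modules and Mathlib only. Axioms:
standard. -/

namespace PercRepro

open Set Matroid

variable {α : Type} (M : Matroid α) [M.Finite]

/-! ## The single through-`y` element of an absorbing pair -/

/-- **THE THROUGH-`y` PAIR OF AN ABSORBING `2`-SET**: for `y ∈ E` in no parallel pair, `4 ≤ #E`, and a
bi-independent `2`-set `Z` with `y ∉ Z`, `y ∈ cl Z`, there is an `e` outside `Z ∪ {y}` with `{y, e}` and
`E ∖ {y, e}` both independent. -/
lemma exists_through_pair {y : α} (hy : y ∈ M.E) (hnp : ∀ z, z ≠ y → y ∉ M.closure {z})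
    (hn : 4 ≤ M.E.ncard) {Z : Set α} (hZ : Z ∈ biIndep M 2) (hyZ : y ∉ Z) (hycl : y ∈ M.closure Z) :
    ∃ e, e ∈ M.E \ insert y Z ∧ M.Indep {y, e} ∧ M.Indep (M.E \ {y, e}) := by
  obtain ⟨hZE, hZ2, hZi, hcind⟩ := hZ
  have hyZE : insert y Z ⊆ M.E := Set.insert_subset hy hZE
  have hZfin : Z.Finite := M.ground_finite.subset hZE
  have hJsub : M.E \ insert y Z ⊆ M.E \ Z := Set.sdiff_subset_sdiff_right (Set.subset_insert y Z)
  have hJi : M.Indep (M.E \ insert y Z) := hcind.subset hJsub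
  have hJfin : (M.E \ insert y Z).Finite := M.ground_finite.subset Set.sdiff_subset
  have hJcard : (M.E \ insert y Z).ncard = M.E.ncard - 3 := by
    rw [Set.ncard_sdiff hyZE (M.ground_finite.subset hyZE), Set.ncard_insert_of_notMem hyZ hZfin, hZ2]
  -- an `e ∈ J` with `E ∖ {y, e}` independent
  have hA : ∃ e ∈ M.E \ insert y Z, M.Indep (M.E \ {y, e}) := by
    by_cases hcol : ∃ e ∈ M.E \ insert y Z, ¬ M.IsColoop e
    · obtain ⟨e, heJ, hec⟩ := hcol
      refine ⟨e, heJ, ?_⟩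
      have heE : e ∈ M.E := heJ.1
      have hye : y ≠ e := fun h => heJ.2 (by rw [← h]; exact Set.mem_insert y Z)
      have hspan : M.Spanning (M.E \ {e}) := by
        by_contra h
        exact hec (Matroid.isColoop_iff_sdiff_not_spanning.mpr h)
      have h1 : M.eRk (M.E \ {e}) = M.eRank := hspan.eRk_eq
      have h3 : ((M.E.ncard - 2 : ℕ) : ℕ∞) ≤ M.eRank := by
        have := hcind.encard_le_eRank
        rwa [← (M.ground_finite.subset Set.sdiff_subset).cast_ncard_eq,
          Set.ncard_sdiff hZE hZfin, hZ2] at this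
      have hZsub : Z ⊆ M.E \ {y, e} := by
        intro x hx
        refine ⟨hZE hx, ?_⟩
        simp only [Set.mem_insert_iff, Set.mem_singleton_iff, not_or]
        exact ⟨fun h => hyZ (h ▸ hx), fun h => heJ.2 (Set.mem_insert_of_mem y (h ▸ hx))⟩
      have hycl2 : y ∈ M.closure (M.E \ {y, e}) := M.closure_subset_closure hZsub hycl
      have hsub : M.E \ {e} ⊆ M.closure (M.E \ {y, e}) := by
        intro x hx
        by_cases hxy : x = y
        · rw [hxy]; exact hycl2
        · refine M.subset_closure _ Set.sdiff_subset ⟨hx.1, ?_⟩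
          have hxe : x ≠ e := by simpa using hx.2
          simp only [Set.mem_insert_iff, Set.mem_singleton_iff, not_or]
          exact ⟨hxy, hxe⟩
      have h6 : M.eRk (M.E \ {e}) ≤ M.eRk (M.E \ {y, e}) := by
        calc M.eRk (M.E \ {e}) ≤ M.eRk (M.closure (M.E \ {y, e})) := M.eRk_mono hsub
          _ = M.eRk (M.E \ {y, e}) := M.eRk_closure_eq _
      have hfin2 : (M.E \ {y, e}).Finite := M.ground_finite.subset Set.sdiff_subset
      have hcard2 : (M.E \ {y, e}).ncard = M.E.ncard - 2 := by
        have hsub2 : ({y, e} : Set α) ⊆ M.E := by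
          rintro x (rfl | rfl)
          · exact hy
          · exact heE
        have hc2 : ({y, e} : Set α).ncard = 2 := by
          rw [Set.ncard_insert_of_notMem (by simpa using hye), Set.ncard_singleton]
        rw [Set.ncard_sdiff hsub2 (M.ground_finite.subset hsub2), hc2]
      rw [Matroid.indep_iff_eRk_eq_encard_of_finite hfin2]
      refine le_antisymm (M.eRk_le_encard _) ?_
      rw [← hfin2.cast_ncard_eq, hcard2]
      exact h3.trans (h1.symm.le.trans h6)
    · simp only [not_exists, not_and, not_not] at hcol
      have hEy : M.Indep (M.E \ {y}) := by
        have hunion : M.E \ {y} = Z ∪ (M.E \ insert y Z) := by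
          ext x
          simp only [Set.mem_sdiff, Set.mem_singleton_iff, Set.mem_union, Set.mem_insert_iff, not_or]
          constructor
          · rintro ⟨hxE, hxy⟩
            by_cases hxZ : x ∈ Z
            · exact Or.inl hxZ
            · exact Or.inr ⟨hxE, hxy, hxZ⟩
          · rintro (hxZ | ⟨hxE, hxy, -⟩)
            · exact ⟨hZE hxZ, fun h => hyZ (h ▸ hxZ)⟩
            · exact ⟨hxE, hxy⟩
        rw [hunion]
        exact (Matroid.union_indep_iff_indep_of_subset_coloops (fun e he => hcol e he)).mpr hZi
      obtain ⟨e, heJ⟩ : (M.E \ insert y Z).Nonempty := by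
        rw [← Set.ncard_pos hJfin]
        omega
      refine ⟨e, heJ, hEy.subset ?_⟩
      intro x hx
      refine ⟨hx.1, fun h => hx.2 ?_⟩
      rw [Set.mem_singleton_iff] at h
      rw [h]
      exact Set.mem_insert y _
  obtain ⟨e, heJ, hind⟩ := hA
  have hye : e ≠ y := fun h => heJ.2 (by rw [h]; exact Set.mem_insert y Z)
  refine ⟨e, heJ, ?_, hind⟩
  have hei : M.Indep {e} := hJi.subset (Set.singleton_subset_iff.mpr heJ)
  rw [show ({y, e} : Set α) = insert y {e} from rfl, hei.insert_indep_iff_of_notMem (by simpa using hye.symm)]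
  exact ⟨hy, hnp e hye⟩

omit [M.Finite] in
/-- A loop absorbs nothing: `A^y_k = 0` for a loop `y` (the complement of a member would contain the loop). -/
lemma absorbCount_eq_zero_of_isLoop {y : α} (hl : M.IsLoop y) (k : ℕ) : lowAbsorbCount M y k = 0 := by
  have hsub : lowAbsorbAt M y k ⊆ {Z ∈ biIndep M k | y ∉ Z} := fun Z hZ => ⟨hZ.1, hZ.2.1⟩
  rw [avoid_eq_empty_of_isLoop M hl k] at hsub
  unfold lowAbsorbCount
  rw [Set.subset_empty_iff.mp hsub, Set.ncard_empty]

omit [M.Finite] in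
/-- For a bi-independent `2`-set `Z` absorbing `y` (`y ∉ Z`, `y ∈ cl Z`) with `y` in no parallel pair,
`insert y Z` is a circuit (the triangle `{y, a, b}`; the same argument as `insert_isCircuit_of_absorb_two` of
`RankLevelSetPerElemTwo`, repeated so that this module rests on `RankLevelSetPerElemLow` alone). -/
lemma insert_isCircuit_of_absorb_pair {y : α} (hnp : ∀ z, z ≠ y → y ∉ M.closure {z}) {Z : Set α}
    (hZi : M.Indep Z) (hZ2 : Z.ncard = 2) (hyZ : y ∉ Z) (hycl : y ∈ M.closure Z) :
    M.IsCircuit (insert y Z) := by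
  refine hZi.insert_isCircuit_of_forall hyZ hycl ?_
  obtain ⟨a, b, hab, rfl⟩ := Set.ncard_eq_two.mp hZ2
  have hya : a ≠ y := fun h => hyZ (by rw [h]; exact Set.mem_insert y _)
  have hyb : b ≠ y := fun h => hyZ (by rw [h]; exact Set.mem_insert_of_mem _ rfl)
  intro f hf
  rcases hf with rfl | hf
  · rw [Set.insert_sdiff_of_mem _ (Set.mem_singleton f), Set.sdiff_singleton_eq_self (by simpa using hab)]
    exact hnp b hyb
  · rw [Set.mem_singleton_iff] at hf
    subst hf
    rw [Set.pair_comm, Set.insert_sdiff_of_mem _ (Set.mem_singleton f),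
      Set.sdiff_singleton_eq_self (by simpa using hab.symm)]
    exact hnp a hya

/-! ## The reflections at the levels `1` and `2` -/

/-- **THE REFLECTION (★★)⁺ AT LEVEL `1` FOR EVERY ELEMENT OF EVERY FINITE MATROID WITH `3 ≤ #E`**:
`A^y_1 ≤ A^y_{#E − 1}`. -/
theorem starPlus_one {y : α} (hy : y ∈ M.E) (hn : 3 ≤ M.E.ncard) :
    lowAbsorbCount M y 1 ≤ lowAbsorbCount M y (M.E.ncard - 1) := by
  by_cases hl : M.IsLoop y
  · rw [absorbCount_eq_zero_of_isLoop M hl 1]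
    exact Nat.zero_le _
  by_cases hp : ∃ z, ParallelPair M y z
  · obtain ⟨z, hz⟩ := hp
    haveI := contract_delete_finite M y z
    have hcard := ncard_ground_contract_delete M hz
    rw [show M.E.ncard - 1 = (M.E.ncard - 2) + 1 by omega, lowAbsorbCount_succ_of_parallel_left M hz 0,
      lowAbsorbCount_succ_of_parallel_left M hz (M.E.ncard - 2), ← hcard]
    have hsym := biIndepCount_compl ((M.contract {y}).delete {z}) 0 (Nat.zero_le _)
    rw [Nat.sub_zero] at hsym
    rw [hsym]
  simp only [not_exists] at hp
  have hnp : ∀ z, z ≠ y → y ∉ M.closure {z} := fun z hz =>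
    notMem_closure_singleton_of_no_partner M hy hl hp hz
  have h0 : lowAbsorbAt M y 1 = ∅ := by
    rw [Set.eq_empty_iff_forall_notMem]
    rintro Z ⟨⟨-, hZ1, hZi, -⟩, hyZ, hdep⟩
    obtain ⟨a, rfl⟩ := Set.ncard_eq_one.mp hZ1
    have hay : a ≠ y := fun h => hyZ (by rw [h]; exact Set.mem_singleton y)
    apply hdep
    rw [hZi.insert_indep_iff_of_notMem hyZ]
    exact ⟨hy, hnp a hay⟩
  unfold lowAbsorbCount
  rw [h0, Set.ncard_empty]
  exact Nat.zero_le _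

/-- **THE REFLECTION (★★)⁺ AT LEVEL `2` FOR EVERY ELEMENT OF EVERY FINITE MATROID WITH `5 ≤ #E`**:
`A^y_2 ≤ A^y_{#E − 2}` — an absorbing pair `Z = {a, b}` goes to `E ∖ {y, e}` for the element `e` of
`exists_through_pair`, and is recovered as the fundamental circuit of `y` there. -/
theorem starPlus_two {y : α} (hy : y ∈ M.E) (hn : 5 ≤ M.E.ncard) :
    lowAbsorbCount M y 2 ≤ lowAbsorbCount M y (M.E.ncard - 2) := by
  by_cases hl : M.IsLoop y
  · rw [absorbCount_eq_zero_of_isLoop M hl 2]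
    exact Nat.zero_le _
  by_cases hp : ∃ z, ParallelPair M y z
  · obtain ⟨z, hz⟩ := hp
    haveI := contract_delete_finite M y z
    have hcard := ncard_ground_contract_delete M hz
    rw [show M.E.ncard - 2 = (M.E.ncard - 3) + 1 by omega, lowAbsorbCount_succ_of_parallel_left M hz 1,
      lowAbsorbCount_succ_of_parallel_left M hz (M.E.ncard - 3),
      show M.E.ncard - 3 = (M.E.ncard - 2) - 1 by omega, ← hcard,
      biIndepCount_compl ((M.contract {y}).delete {z}) 1 (by rw [hcard]; omega)]
  simp only [not_exists] at hp
  have hnp : ∀ z, z ≠ y → y ∉ M.closure {z} := fun z hz =>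
    notMem_closure_singleton_of_no_partner M hy hl hp hz
  have hex : ∀ Z : Set α, ∃ W : Set α, Z ∈ lowAbsorbAt M y 2 →
      W ∈ lowAbsorbAt M y (M.E.ncard - 2) ∧ Z ⊆ W := by
    intro Z
    by_cases hZ : Z ∈ lowAbsorbAt M y 2
    · obtain ⟨hZb, hyZ, hdep⟩ := hZ
      have hycl : y ∈ M.closure Z := by
        rw [hZb.2.2.1.mem_closure_iff_of_notMem hyZ, Matroid.dep_iff]
        exact ⟨hdep, Set.insert_subset hy hZb.1⟩
      obtain ⟨e, heJ, hpair, hcomp⟩ := exists_through_pair M hy hnp (by omega) hZb hyZ hycl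
      have hye : y ≠ e := fun h => heJ.2 (by rw [← h]; exact Set.mem_insert y Z)
      have hsub2 : ({y, e} : Set α) ⊆ M.E := by
        rintro x (rfl | rfl)
        · exact hy
        · exact heJ.1
      have hZsub : Z ⊆ M.E \ {y, e} := by
        intro x hx
        refine ⟨hZb.1 hx, ?_⟩
        simp only [Set.mem_insert_iff, Set.mem_singleton_iff, not_or]
        exact ⟨fun h => hyZ (h ▸ hx), fun h => heJ.2 (Set.mem_insert_of_mem y (h ▸ hx))⟩
      refine ⟨M.E \ {y, e}, fun _ => ⟨⟨⟨Set.sdiff_subset, ?_, hcomp, ?_⟩, ?_, ?_⟩, hZsub⟩⟩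
      · have hc2 : ({y, e} : Set α).ncard = 2 := by
          rw [Set.ncard_insert_of_notMem (by simpa using hye), Set.ncard_singleton]
        rw [Set.ncard_sdiff hsub2 (M.ground_finite.subset hsub2), hc2]
      · rw [Set.sdiff_sdiff_right_self, Set.inter_eq_right.mpr hsub2]
        exact hpair
      · exact fun h => h.2 (Set.mem_insert y _)
      · intro hind
        exact (hind.subset (Set.insert_subset_insert hZsub)).not_dep
          (by rw [Matroid.dep_iff]; exact ⟨hdep, Set.insert_subset hy hZb.1⟩)
    · exact ⟨∅, fun h => absurd h hZ⟩
  choose f hf using hex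
  unfold lowAbsorbCount
  refine Set.ncard_le_ncard_of_injOn f (fun Z hZ => (hf Z hZ).1) ?_ (lowAbsorbAt_finite M y _)
  intro Z₁ hZ₁ Z₂ hZ₂ heq
  obtain ⟨hW₁, hs₁⟩ := hf Z₁ hZ₁
  obtain ⟨-, hs₂⟩ := hf Z₂ hZ₂
  have hWi : M.Indep (f Z₁) := hW₁.1.2.2.1
  have hcirc : ∀ {Z : Set α}, Z ∈ lowAbsorbAt M y 2 → M.IsCircuit (insert y Z) := by
    rintro Z ⟨hZb, hyZ, hdep⟩
    have hycl : y ∈ M.closure Z := by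
      rw [hZb.2.2.1.mem_closure_iff_of_notMem hyZ, Matroid.dep_iff]
      exact ⟨hdep, Set.insert_subset hy hZb.1⟩
    exact insert_isCircuit_of_absorb_pair M hnp hZb.2.2.1 hZb.2.1 hyZ hycl
  have hC₁ : insert y Z₁ = M.fundCircuit y (f Z₁) :=
    (hcirc hZ₁).eq_fundCircuit_of_subset hWi (Set.insert_subset_insert hs₁)
  have hC₂ : insert y Z₂ = M.fundCircuit y (f Z₁) :=
    (hcirc hZ₂).eq_fundCircuit_of_subset hWi (Set.insert_subset_insert (by rw [heq]; exact hs₂))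
  have heq' : insert y Z₁ = insert y Z₂ := by rw [hC₁, hC₂]
  have : (insert y Z₁) \ {y} = (insert y Z₂) \ {y} := by rw [heq']
  rwa [Set.insert_sdiff_of_mem _ (Set.mem_singleton y), Set.insert_sdiff_of_mem _ (Set.mem_singleton y),
    Set.sdiff_singleton_eq_self hZ₁.2.1, Set.sdiff_singleton_eq_self hZ₂.2.1] at this

end PercRepro
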